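import Mathlib
import HarnessLib
import Literature.MathematicalPhysics.QuantumLattice.HubbardGridCharacters
import Literature.Probability.LatticeModels.TorusBlockFourier
import Summits.HubbardSuperconductivity.HubbardSuperconductivity.Theorems.KLProgrammeKLRegimeSliceSymbolTorus

/-!
# Route `KLProgramme` — crux K3 ENGINE (stmt-HubbardSuperconductivity-20437), (X).3 class #5 rows 54b/56, located finding «(N_g)-GRID-ALPHA-FLOOR»
# (NEGATIVE KNOWLEDGE): the plain decay constant of a (partial) slice on the `4M`-grid is at least `(N/β)·|W|/ρ` at EVERY shell point — it cannot
# be smaller than `(N/β)·c/Λ_n`, so the label-blind grid step's smallness `θ_n = e·α·normV/κ²` grows like `1/Λ_n` down the tower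

Cell `gate-hubbard-kl`, seat p3 (g19); pen (R261)(2) «(N_g)-GRID-EXPORT α-PART», sizing before building (bus 2026-08-28 ≈19:25Z).
The door `klmg_gridNorms_running_of_partialStep` (…EnginePairTransferGridRunningStep) turns the pinned GRID norms of `Gg(Λ_n)` into those of `Gg(Λ(t))`
through ONE Gaussian step with the partial-slice covariance `S_Nᵀ(C^K_{>Λ(t)} − C^K_{>Λ_n})S_N`, given its Gram constant (√6047, fixed), its plain row /
column sums `α` and the smallness `e·α·normV(√6047,ρ,N_n)/6047 < 1`.  This file records what `α` CANNOT do: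

* §1 **`rowSum_gridSub_pullback_ge_gridSymbol`** — GENERIC: for every symbol `p`, grid leg `((j,x⃗),σ,+)` and every dual point `(q₀,q⃗)`,
  `N·L²·‖G_σ(q₀,q⃗)‖ ≤ Σ_Y ‖(S_Nᵀ·N_p·S_N)(((j,x⃗),σ,+), Y)‖` (`G = gridSymbol`, character orthogonality on `ℤ/N × (ℤ/L)²`: a row of a translation-invariant
  kernel dominates every Fourier coefficient);
* §2 **`norm_gridSymbol_sliceCT`** — for the slice symbol `Ψ̂_{(Λ,Λ′]}[K]` at a Matsubara point: `‖G_σ(i,k⃗)‖ = |W(ω_i, e_K(k⃗))|/(βL²·‖−iω_i + e_K(k⃗)‖)`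
  (`W` = the slice weight ∈ [0,1]);
* §3 **`rowSum_gridSub_sliceCT_ge`** — hence for `C^K_{>Λ} − C^K_{>Λ′} = hubbardCovSliceCT … K Λ Λ′` on the grid `N ≥ 2M`:
  `(N/β)·|W(ω_i,e_K(k⃗))|/‖−iω_i + e_K(k⃗)‖ ≤ Σ_Y ‖(S_Nᵀ(C^K_{>Λ} − C^K_{>Λ′})S_N)(X,Y)‖` for every `(i, k⃗)` — at a shell point (`ρ ≤ Λ′`, `W ≥ ½`) this is
  `≥ (N/β)/(2Λ′)`: the symbol's SUP alone forces `α_n ≳ (N/β)/Λ_n` [the true size, by the circle's stationary phase, is `(N/β)·C·Λ_n^{−3/2}` — hand].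
  With `normV(κ,ρ,N) ≥ (e²κ)⁴·N(2)` and `N_n(2) ≥` the quartic coupling's grid weight `≍ U·β/N`, the door's `θ_n ≳ e⁹·6047·U/Λ_n`: open only while
  `Λ_n ≳ 10⁷·U`, never along a KL tower (`Λ_{n_β} ≍ π/β`, `β` up to `e^{c/U²}`) — the d = 2 label-blind power-counting loss; running scales need SECTOR currency.

Everything here is proved (§1–§3); the bracketed consequences are arithmetic on the door's hypotheses, recorded for the pen / class #5.  No definition, no sorry;
nothing asserts or denies (X).3, any stub, K3 or superconductivity.  [cite: BenfattoGiulianiMastropietro2006, §2.1 (2.3), Lemma 2.2 (2.81), §2.7 (2.77)–(2.80)]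
-/

noncomputable section

namespace Summit.HubbardSuperconductivity.HubbardSuperconductivity.Theorems.TorusFourierL2

set_option linter.dupNamespace false -- summit = problem name (single-conjunct summit), D-0017

open Finset Complex Literature.MathematicalPhysics.QuantumLattice Literature.Probability.LatticeModels
open Summit.HubbardSuperconductivity.HubbardSuperconductivity.Theorems.KLRegimeSplit
open scoped Real ComplexConjugate

/-! ## §1 A row dominates every Fourier coefficient of the symbol -/

section Generic

variable {L M N : ℕ} [NeZero L] [NeZero N]

/-- **Character orthogonality against one test character on the product torus**:
`Σ_{a,b} (Σ_{q₀,q⃗} χ_{q₀}(a)χ_{q⃗}(b)G(q₀,q⃗))·conj χ_{q₀*}(a)·conj χ_{q⃗*}(b) = N·L²·G(q₀*,q⃗*)`. [folklore] -/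
theorem sum_charSum_mul_conj_eq (G : TorusSite 1 N → TorusSite 2 L → ℂ) (q₀ : TorusSite 1 N) (qv : TorusSite 2 L) :
    ∑ a : TorusSite 1 N, ∑ bv : TorusSite 2 L,
        (∑ q₀' : TorusSite 1 N, ∑ qv' : TorusSite 2 L, torusChar q₀' a * torusChar qv' bv * G q₀' qv') * (conj (torusChar q₀ a) * conj (torusChar qv bv)) =
      ((N : ℂ) * (L : ℂ) ^ 2) * G q₀ qv := by
  classical
  -- expand each term as a sum over the product of the dual indices
  have hre : ∀ (a : TorusSite 1 N) (bv : TorusSite 2 L),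
      (∑ q₀' : TorusSite 1 N, ∑ qv' : TorusSite 2 L, torusChar q₀' a * torusChar qv' bv * G q₀' qv') * (conj (torusChar q₀ a) * conj (torusChar qv bv)) =
        ∑ q : TorusSite 1 N × TorusSite 2 L, G q.1 q.2 * ((torusChar q.1 a * conj (torusChar q₀ a)) * (torusChar q.2 bv * conj (torusChar qv bv))) := by
    intro a bv
    rw [Fintype.sum_prod_type, Finset.sum_mul]
    refine sum_congr rfl fun q₀' _ => ?_
    rw [Finset.sum_mul]
    exact sum_congr rfl fun qv' _ => by ring
  simp_rw [hre]
  rw [← Fintype.sum_prod_type' (f := fun (a : TorusSite 1 N) (bv : TorusSite 2 L) =>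
    ∑ q : TorusSite 1 N × TorusSite 2 L, G q.1 q.2 * ((torusChar q.1 a * conj (torusChar q₀ a)) * (torusChar q.2 bv * conj (torusChar qv bv))))]
  rw [Finset.sum_comm]
  -- per dual index: factor the two orthogonality sums
  have hinner : ∀ q : TorusSite 1 N × TorusSite 2 L,
      ∑ ab : TorusSite 1 N × TorusSite 2 L, G q.1 q.2 * ((torusChar q.1 ab.1 * conj (torusChar q₀ ab.1)) * (torusChar q.2 ab.2 * conj (torusChar qv ab.2))) =
        G q.1 q.2 * ((if q.1 = q₀ then ((N : ℂ)) ^ 1 else 0) * (if q.2 = qv then ((L : ℂ)) ^ 2 else 0)) := by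
    intro q
    rw [← Finset.mul_sum, ← TorusBlock.sum_torusChar_mul_conj q.1 q₀, ← TorusBlock.sum_torusChar_mul_conj q.2 qv, Finset.sum_mul_sum,
      ← Fintype.sum_prod_type' (f := fun (a : TorusSite 1 N) (bv : TorusSite 2 L) =>
        (torusChar q.1 a * conj (torusChar q₀ a)) * (torusChar q.2 bv * conj (torusChar qv bv)))]
  simp_rw [hinner]
  rw [Finset.sum_eq_single (q₀, qv) (fun q _ hne => ?_) (fun h => absurd (mem_univ _) h)]
  · simp only [if_true, pow_one]
    ring
  · obtain ⟨q₁, q₂⟩ := q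
    simp only [ne_eq, Prod.mk.injEq, not_and_or] at hne
    rcases hne with h | h
    · simp [h]
    · simp [h]

/-- **A ROW OF THE GRID PULL-BACK DOMINATES EVERY FOURIER COEFFICIENT OF THE SYMBOL**: for `2M ≤ N`, `β ≠ 0`, every symbol `p`, every grid leg
`((j,x⃗),σ,+)` and every dual point `(q₀,q⃗)`: `N·L²·‖gridSymbol p σ q₀ q⃗‖ ≤ Σ_Y ‖(S_Nᵀ·N_p·S_N)(((j,x⃗),σ,+),Y)‖`.
[cite: BenfattoGiulianiMastropietro2006, §2.1 (2.3), Lemma 2.2 (2.81)] -/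
theorem rowSum_gridSub_pullback_ge_gridSymbol {β : ℝ} (hβ : β ≠ 0) (hN : 2 * M ≤ N) (p : FreqMomentum L M × Fin 2 → ℂ) (j : Fin N)
    (x : TorusSite 2 L) (σ : Fin 2) (q₀ : TorusSite 1 N) (qv : TorusSite 2 L) :
    (N : ℝ) * (L : ℝ) ^ 2 * ‖gridSymbol L M N β p σ q₀ qv‖ ≤
      ∑ Y : GridLeg (GridPoint L N), ‖((hubbardGridSub L M β N).transpose * normalCovariance L M p * hubbardGridSub L M β N) (((j, x), σ), 0) Y‖ := by
  classical
  set C := (hubbardGridSub L M β N).transpose * normalCovariance L M p * hubbardGridSub L M β N with hC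
  set S : TorusSite 1 N → TorusSite 2 L → ℂ := fun a bv =>
    ∑ q₀' : TorusSite 1 N, ∑ qv' : TorusSite 2 L, torusChar q₀' a * torusChar qv' bv * gridSymbol L M N β p σ q₀' qv' with hS
  -- (1) the row dominates the sub-row over the legs `((b,σ),−)`
  have hsub : ∑ b : GridPoint L N, ‖C (((j, x), σ), 0) ((b, σ), 1)‖ ≤ ∑ Y : GridLeg (GridPoint L N), ‖C (((j, x), σ), 0) Y‖ := by
    conv_rhs => rw [Fintype.sum_prod_type, Fintype.sum_prod_type]
    refine Finset.sum_le_sum fun b _ => ?_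
    calc ‖C (((j, x), σ), 0) ((b, σ), 1)‖ ≤ ∑ c : Fin 2, ‖C (((j, x), σ), 0) ((b, σ), c)‖ :=
          Finset.single_le_sum (f := fun c : Fin 2 => ‖C (((j, x), σ), 0) ((b, σ), c)‖) (fun _ _ => norm_nonneg _) (mem_univ (1 : Fin 2))
      _ ≤ ∑ σ' : Fin 2, ∑ c : Fin 2, ‖C (((j, x), σ), 0) ((b, σ'), c)‖ :=
          Finset.single_le_sum (f := fun σ' : Fin 2 => ∑ c : Fin 2, ‖C (((j, x), σ), 0) ((b, σ'), c)‖)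
            (fun _ _ => sum_nonneg fun _ _ => norm_nonneg _) (mem_univ σ)
  refine le_trans ?_ hsub
  -- (2) the sub-row is the `ℓ¹` norm of the character sums over the product torus
  have hrow : ∑ b : GridPoint L N, ‖C (((j, x), σ), 0) ((b, σ), 1)‖ = ∑ a : TorusSite 1 N, ∑ bv : TorusSite 2 L, ‖S a bv‖ := by
    calc ∑ b : GridPoint L N, ‖C (((j, x), σ), 0) ((b, σ), 1)‖
        = ∑ b : GridPoint L N, ‖∑ q₀' : TorusSite 1 N, ∑ qv' : TorusSite 2 L,
            torusChar q₀' (fun _ : Fin 1 => ((j : ℕ) : ZMod N) - ((b.1 : ℕ) : ZMod N)) * torusChar qv' (x - b.2) *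
              gridSymbol L M N β p σ q₀' qv'‖ := sum_congr rfl fun b _ => by
          rw [hC]; exact norm_gridSub_pullback_apply_zero_one_eq hβ hN p j b.1 x b.2 σ
      _ = ∑ a : TorusSite 1 N, ∑ bv : TorusSite 2 L, ‖S a bv‖ := sum_gridPoint_eq_sum_prodTorus (fun a bv => ‖S a bv‖) j x
  rw [hrow]
  -- (3) test against the character `(q₀, q⃗)`: orthogonality and the triangle inequality
  have horth := sum_charSum_mul_conj_eq (fun q₀' qv' => gridSymbol L M N β p σ q₀' qv') q₀ qv
  have htri : ‖∑ a : TorusSite 1 N, ∑ bv : TorusSite 2 L, S a bv * (conj (torusChar q₀ a) * conj (torusChar qv bv))‖ ≤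
      ∑ a : TorusSite 1 N, ∑ bv : TorusSite 2 L, ‖S a bv‖ := by
    refine (norm_sum_le _ _).trans (sum_le_sum fun a _ => (norm_sum_le _ _).trans (sum_le_sum fun bv _ => ?_))
    rw [norm_mul, norm_mul, RCLike.norm_conj, RCLike.norm_conj, norm_torusChar, norm_torusChar, mul_one, mul_one]
  have hval : ‖∑ a : TorusSite 1 N, ∑ bv : TorusSite 2 L, S a bv * (conj (torusChar q₀ a) * conj (torusChar qv bv))‖ =
      (N : ℝ) * (L : ℝ) ^ 2 * ‖gridSymbol L M N β p σ q₀ qv‖ := by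
    simp only [hS]
    rw [horth, norm_mul, norm_mul, norm_pow, Complex.norm_natCast, Complex.norm_natCast]
  rw [← hval]
  exact htri

end Generic

/-! ## §2 The slice symbol's grid value at a Matsubara point -/

section Slice

variable {L M : ℕ} [NeZero L] [NeZero M]

omit [NeZero M] in
/-- **The grid symbol of the slice at a Matsubara point**: `‖G_σ(i,k⃗)‖ = |W(ω_i,e_K(k⃗))|/(βL²·‖−iω_i + e_K(k⃗)‖)` (`0 < β`, `2M ≤ N`).
[cite: BenfattoGiulianiMastropietro2006, §2.3 (2.19), §2.1 (2.3)] -/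
theorem norm_gridSymbol_sliceCT {N : ℕ} [NeZero N] {β : ℝ} (hβ : 0 < β) (hN : 2 * M ≤ N) (μ : ℝ) (K : TrigPolyC4v) (Λ Λ' : ℝ) (σ : Fin 2)
    (i : MatsubaraIdx M) (k : TorusSite 2 L) :
    ‖gridSymbol L M N β (fun ks => sliceSymbolFnXi (β * (L : ℝ) ^ 2) 0 Λ Λ' (matsubaraFreq β M ks.1.1) (nambuXiCT L μ K ks.1.2)) σ
        (fun _ : Fin 1 => ((i : ℕ) : ZMod N)) k‖ =
      |sliceWeightFn Λ Λ' (matsubaraFreq β M i) (nambuXiCT L μ K k)| /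
        (β * (L : ℝ) ^ 2 * ‖-I * (((matsubaraFreq β M i + 0 : ℝ) : ℂ)) + ((nambuXiCT L μ K k : ℝ) : ℂ)‖) := by
  have hL : (0 : ℝ) < L := by exact_mod_cast Nat.pos_of_ne_zero (NeZero.ne L)
  have hc : 0 < β * (L : ℝ) ^ 2 := by positivity
  have hval : ((fun _ : Fin 1 => ((i : ℕ) : ZMod N)) 0).val = (i : ℕ) := val_natCast_matsubaraIdx_of_le hN i
  have hlt : ((fun _ : Fin 1 => ((i : ℕ) : ZMod N)) 0).val < 2 * M := by rw [hval]; exact i.isLt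
  rw [gridSymbol, dif_pos hlt]
  have hi : (⟨((fun _ : Fin 1 => ((i : ℕ) : ZMod N)) 0).val, hlt⟩ : MatsubaraIdx M) = i := Fin.ext hval
  simp only [hi]
  rw [norm_mul, norm_pow, Complex.norm_real, Real.norm_of_nonneg (by positivity), sliceSymbolFnXi, norm_mul, Complex.norm_real, Real.norm_eq_abs,
    norm_resolventFnXi hc.le]
  set W := |sliceWeightFn Λ Λ' (matsubaraFreq β M i) (nambuXiCT L μ K k)|
  set D := ‖-I * (((matsubaraFreq β M i + 0 : ℝ) : ℂ)) + ((nambuXiCT L μ K k : ℝ) : ℂ)‖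
  by_cases hD : D = 0
  · rw [hD]; simp
  · field_simp

/-! ## §3 The floor of the slice's decay constant on the grid -/

omit [NeZero M] in
/-- **THE FLOOR OF THE GRID DECAY CONSTANT OF A SLICE** («(N_g)-GRID-ALPHA-FLOOR»): for the slice / partial slice `C^K_{>Λ} − C^K_{>Λ′}`
(`= hubbardCovSliceCT … K Λ Λ′`) pulled back to the `N`-point grid (`2M ≤ N`, `0 < β`), every grid leg `((j,x⃗),σ,+)` and EVERY Matsubara point `(i, k⃗)`:
`(N/β)·|W(ω_i,e_K(k⃗))|/‖−iω_i + e_K(k⃗)‖ ≤ Σ_Y ‖(S_Nᵀ(C^K_{>Λ} − C^K_{>Λ′})S_N)(((j,x⃗),σ,+), Y)‖`.  At a shell point (`‖−iω+e‖ ≤ Λ′`, `W ≥ ½`) the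
row is `≥ (N/β)/(2Λ′)`: no `M`-, `β`-, `L`-uniform decay constant better than `(N/β)·c/Λ_n` exists for the scale-`n` step in grid currency.
[cite: BenfattoGiulianiMastropietro2006, Lemma 2.2 (2.81)] -/
theorem rowSum_gridSub_sliceCT_ge {N : ℕ} [NeZero N] {β : ℝ} (hβ : 0 < β) (hN : 2 * M ≤ N) (μ : ℝ) (K : TrigPolyC4v) (Λ Λ' : ℝ)
    (j : Fin N) (x : TorusSite 2 L) (σ : Fin 2) (i : MatsubaraIdx M) (k : TorusSite 2 L) :
    (N : ℝ) / β * (|sliceWeightFn Λ Λ' (matsubaraFreq β M i) (nambuXiCT L μ K k)| /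
        ‖-I * (((matsubaraFreq β M i + 0 : ℝ) : ℂ)) + ((nambuXiCT L μ K k : ℝ) : ℂ)‖) ≤
      ∑ Y : GridLeg (GridPoint L N), ‖((hubbardGridSub L M β N).transpose * hubbardCovSliceCT L M β μ 0 K Λ Λ' * hubbardGridSub L M β N) (((j, x), σ), 0) Y‖ := by
  have hL : (0 : ℝ) < L := by exact_mod_cast Nat.pos_of_ne_zero (NeZero.ne L)
  rw [hubbardCovSliceCT_eq_normalCovariance_sliceSymbolFnXi hβ.ne' μ K Λ Λ']
  have h := rowSum_gridSub_pullback_ge_gridSymbol (L := L) (M := M) (N := N) hβ.ne' hN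
    (fun ks => sliceSymbolFnXi (β * (L : ℝ) ^ 2) 0 Λ Λ' (matsubaraFreq β M ks.1.1) (nambuXiCT L μ K ks.1.2)) j x σ (fun _ : Fin 1 => ((i : ℕ) : ZMod N)) k
  rw [norm_gridSymbol_sliceCT hβ hN μ K Λ Λ' σ i k] at h
  refine le_trans (le_of_eq ?_) h
  field_simp

omit [NeZero M] in
/-- **The shell form**: if the point lies in the shell (`‖−iω_i + e_K(k⃗)‖ ≤ Λ′`) and carries slice weight `W ≥ w₀ ≥ 0`, then the row is
`≥ (N/β)·w₀/Λ′`. [cite: BenfattoGiulianiMastropietro2006, Lemma 2.2 (2.81)] -/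
theorem rowSum_gridSub_sliceCT_ge_of_shell {N : ℕ} [NeZero N] {β : ℝ} (hβ : 0 < β) (hN : 2 * M ≤ N) (μ : ℝ) (K : TrigPolyC4v) (Λ Λ' : ℝ) (j : Fin N) (x : TorusSite 2 L) (σ : Fin 2) (i : MatsubaraIdx M) (k : TorusSite 2 L) {w₀ : ℝ} (hw₀ : 0 ≤ w₀)
    (hW : w₀ ≤ |sliceWeightFn Λ Λ' (matsubaraFreq β M i) (nambuXiCT L μ K k)|)
    (hshell : ‖-I * (((matsubaraFreq β M i + 0 : ℝ) : ℂ)) + ((nambuXiCT L μ K k : ℝ) : ℂ)‖ ≤ Λ') :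
    (N : ℝ) / β * (w₀ / Λ') ≤
      ∑ Y : GridLeg (GridPoint L N), ‖((hubbardGridSub L M β N).transpose * hubbardCovSliceCT L M β μ 0 K Λ Λ' * hubbardGridSub L M β N) (((j, x), σ), 0) Y‖ := by
  refine le_trans ?_ (rowSum_gridSub_sliceCT_ge hβ hN μ K Λ Λ' j x σ i k)
  refine mul_le_mul_of_nonneg_left ?_ (by positivity)
  have hD0 : 0 < ‖-I * (((matsubaraFreq β M i + 0 : ℝ) : ℂ)) + ((nambuXiCT L μ K k : ℝ) : ℂ)‖ := by
    rw [norm_pos_iff]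
    intro h0
    have hω : matsubaraFreq β M i ≠ 0 := matsubaraFreq_ne_zero hβ.ne' i
    have him := congr_arg Complex.im h0
    simp at him
    exact hω him
  calc w₀ / Λ' ≤ w₀ / ‖-I * (((matsubaraFreq β M i + 0 : ℝ) : ℂ)) + ((nambuXiCT L μ K k : ℝ) : ℂ)‖ := div_le_div_of_nonneg_left hw₀ hD0 hshell
    _ ≤ _ := div_le_div_of_nonneg_right hW hD0.le

end Slice

end Summit.HubbardSuperconductivity.HubbardSuperconductivity.Theorems.TorusFourierL2

end
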